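import Mathlib
import Summits.ValiantsHypothesis.ValiantsHypothesis.Theorems.KPlusLogSqLawWeakLiftingTowerGraftFibreReality

/-!
# Tower graft line — T3 structure: SIGNED FIBRE FLUX — positive and negative fibre roots separately; a DEFINITE base has totally real fibres

Sequel to `…TowerGraftFibreReality.lean` (same seat; LINE (B) `Cruxes/WeakLifting/Lines/tower_graft.lean`, crux `WeakLifting` =
stmt-ValiantsHypothesis-19561, memo `tower_graft-S5.md` §1 (Ed)/§3 T3).  NO stub is claimed.

The prequel's flux runs from `T = −∞` to `T = +∞` and sees only `|π(S) − ν(S)|`.  Running it on the two half-lines separately, through the base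
point `T = 0` where the fibre matrix is the BASE `G` itself (assumed non-singular, i.e. off the `(E0)` events `det G(t) = 0` of the memo), gives the
SIGNED FLUX (§1): `#{T > 0 : det(T·S + G) = 0} ≥ |ν(S) − ν(G)|` and `#{T < 0 : …} ≥ |π(S) − ν(G)|` (with multiplicity;
`card_posRoots_fibre_ge`, `card_negRoots_fibre_ge`), hence `#{real fibre roots} ≥ |ν(S) − ν(G)| + |π(S) − ν(G)| ≥ |π(S) − ν(S)|`
(`card_roots_fibre_ge_signed_flux`).  COROLLARY (§2, `card_roots_fibre_eq_card_of_posDef`): if the base `G` is positive DEFINITE the fibre is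
TOTALLY REAL — exactly `ν(S)` positive and `π(S)` negative roots, `m` in all — so NO FOLD of any far letter can sit over a point `t` where the class
pencil `G(t)` is definite: the folds of T3 live over the indefinite zone of the base (for a tower pencil with definite bottom letter `S₀ ≻ 0`, away
from `t → 0⁺`).  Mechanism: the inertia kit's one-gap certificate `Inertia.dist_negIndex_le_card_roots_gap` on `[ε, T₀]` and `[−T₀, −ε]` with local
constancy of the index at the non-singular points `u = 0` of `u ↦ ±S + u·G` (ends) and of `u ↦ G + u·S` (base).
HONEST FRAMING: structure of the fibres only; the NUMBER of folds over the indefinite zone is not bounded; nothing on S4/S4b/S5, TowerB,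
`WeakLifting`, Conjecture B, `MatrixDescartes` (18050) or VP ≠ VNP.  Def-free; Mathlib + the prequel (inertia kit).  Seat: prover val-sym-lift-p2
g22, `--supports stmt-ValiantsHypothesis-19561 --as helper`.
-/

-- `Summit.ValiantsHypothesis.ValiantsHypothesis.…` repeats a component by the D-0017 layout
-- (single-conjunct summit), which the `dupNamespace` linter flags; the name is mandated.
set_option linter.dupNamespace false

namespace Summit.ValiantsHypothesis.ValiantsHypothesis.Theorems.KPlusLogSqLaw.TowerGraft

open Polynomial Matrix Finset Filter
open scoped BigOperators Topology
open Summit.ValiantsHypothesis.ValiantsHypothesis.Theorems.LacunarySymmetroidMatrixDescartes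
open Summit.ValiantsHypothesis.ValiantsHypothesis.Theorems.LacunarySymmetroidMatrixDescartes.Inertia

variable {ι : Type} [Fintype ι] [DecidableEq ι]

/-! ## §1 Signed flux through the base point `T = 0` -/

section Signed

/-- a small positive parameter inside an `𝓝 0`-eventuality. [folklore] -/
theorem exists_pos_of_eventually_nhds_zero {P : ℝ → Prop} (h : ∀ᶠ u in 𝓝 (0 : ℝ), P u) : ∃ u : ℝ, 0 < u ∧ P u := by
  obtain ⟨ε, hε, hball⟩ := Metric.eventually_nhds_iff.mp h
  refine ⟨ε / 2, by linarith, hball ?_⟩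
  rw [Real.dist_eq, sub_zero, abs_of_pos (by linarith)]
  linarith

/-- **POSITIVE HALF-LINE FLUX.**  `G`, `S` real symmetric and BOTH non-singular: the fibre polynomial `det (X·S + G)` has at least
`|ν(S) − ν(G)|` roots in `(0, ∞)` counted with multiplicity (index of `G + T·S` runs from `ν(G)` at `T = 0⁺` to `ν(S)` at `T → +∞`). [this work] -/
theorem card_posRoots_fibre_ge (G S : Matrix ι ι ℝ) (hG : G.IsSymm) (hS : S.IsSymm) (hGdet : G.det ≠ 0) (hSdet : S.det ≠ 0) :
    Nat.dist (Fintype.card {j // (isHermitian_of_isSymm hS).eigenvalues j < 0})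
        (Fintype.card {j // (isHermitian_of_isSymm hG).eigenvalues j < 0})
      ≤ Multiset.card (((X : ℝ[X]) • S.map C + G.map C).det.roots.filter (fun T => 0 < T)) := by
  classical
  -- the end family at `+∞` and the base family at `0`
  set A : ℝ → Matrix ι ι ℝ := fun u => S + u • G with hA
  set F : ℝ → Matrix ι ι ℝ := fun u => G + u • S with hF
  have hAc : ∀ i j, Continuous fun u => A u i j := by
    intro i j
    simp only [hA, Matrix.add_apply, Matrix.smul_apply, smul_eq_mul]
    exact continuous_const.add (continuous_id.mul continuous_const)
  have hFc : ∀ i j, Continuous fun u => F u i j := by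
    intro i j
    simp only [hF, Matrix.add_apply, Matrix.smul_apply, smul_eq_mul]
    exact continuous_const.add (continuous_id.mul continuous_const)
  have hAH : ∀ u, (A u).IsHermitian := fun u => isHermitian_of_isSymm (by simp only [hA]; exact hS.add (hG.smul u))
  have hFH : ∀ u, (F u).IsHermitian := fun u => isHermitian_of_isSymm (by simp only [hF]; exact hG.add (hS.smul u))
  have hA0 : (A 0).det ≠ 0 := by simp only [hA, zero_smul, add_zero]; exact hSdet
  have hF0 : (F 0).det ≠ 0 := by simp only [hF, zero_smul, add_zero]; exact hGdet
  have hdetA : ∀ᶠ u in 𝓝 (0 : ℝ), (A u).det ≠ 0 :=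
    (Continuous.matrix_det (continuous_pi fun i => continuous_pi fun j => hAc i j)).continuousAt.eventually_ne hA0
  have hdetF : ∀ᶠ u in 𝓝 (0 : ℝ), (F u).det ≠ 0 :=
    (Continuous.matrix_det (continuous_pi fun i => continuous_pi fun j => hFc i j)).continuousAt.eventually_ne hF0
  -- a common small parameter `w ≤ 1` for the end family and the base family; base scale `w`, end scale `w⁻¹ ≥ w`
  obtain ⟨ε, hε, hball⟩ := Metric.eventually_nhds_iff.mp
    (((eventually_negIndex_eq A hAc hAH 0 hA0).and hdetA).and ((eventually_negIndex_eq F hFc hFH 0 hF0).and hdetF))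
  set w : ℝ := min (ε / 2) 1 with hw
  have hw0 : 0 < w := lt_min (by linarith) one_pos
  have hw1 : w ≤ 1 := min_le_right _ _
  have hwdist : dist w 0 < ε := by
    rw [Real.dist_eq, sub_zero, abs_of_pos hw0]; exact lt_of_le_of_lt (min_le_left _ _) (by linarith)
  obtain ⟨⟨hνAw, hAw⟩, hνFw, hFw⟩ := hball hwdist
  set T₀ : ℝ := w⁻¹ with hT₀
  have hT₀0 : 0 < T₀ := inv_pos.mpr hw0
  have hT₀ne : T₀ ≠ 0 := hT₀0.ne'
  have hwT₀ : w ≤ T₀ := by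
    rw [hT₀]; exact le_trans hw1 (one_le_inv_iff₀.mpr ⟨hw0, hw1⟩)
  have hinv : T₀⁻¹ = w := by rw [hT₀, inv_inv]
  -- pencil data
  set d : Fin 2 → ℕ := ![0, 1] with hd
  set L : Fin 2 → Matrix ι ι ℝ := ![G, S] with hL
  have hLs : ∀ k, (L k).IsSymm := fibre_letters_isSymm hG hS
  have hpoly : (∑ k, (X : ℝ[X]) ^ d k • (L k).map C) = (X : ℝ[X]) • S.map C + G.map C := fibre_pencil_poly G S
  have hdet : Matrix.det (∑ k, ((X : ℝ[X]) ^ d k) • (L k).map C) ≠ 0 := by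
    rw [hpoly]; exact det_fibre_ne_zero G S hSdet
  have hend : (∑ k, T₀ ^ d k • L k) = T₀ • A w := by
    rw [fibre_pencil_eval, add_smul_eq_smul_add_inv_smul G S hT₀ne, hinv]
  have hbase : (∑ k, w ^ d k • L k) = F w := by rw [fibre_pencil_eval]
  have hb : (∑ k, T₀ ^ d k • L k).det ≠ 0 := by
    rw [hend, det_smul]; exact mul_ne_zero (pow_ne_zero _ hT₀ne) hAw
  have ha : (∑ k, w ^ d k • L k).det ≠ 0 := by rw [hbase]; exact hFw
  have hgap := dist_negIndex_le_card_roots_gap d L hLs hdet hwT₀ ha hb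
  have hXA : (T₀ • A w).IsHermitian := isHermitian_of_isSymm ((hS.add (hG.smul w)).smul T₀)
  have hνend : Fintype.card {j // (isHermitian_pencil d L hLs T₀).eigenvalues j < 0} =
      Fintype.card {j // (isHermitian_of_isSymm hS).eigenvalues j < 0} := by
    rw [negIndex_congr (isHermitian_pencil d L hLs T₀) hXA hend, negIndex_smul_pos (hAH w) hT₀0 hXA, hνAw]
    exact negIndex_congr (hAH 0) _ (by simp only [hA, zero_smul, add_zero])
  have hνbase : Fintype.card {j // (isHermitian_pencil d L hLs w).eigenvalues j < 0} =
      Fintype.card {j // (isHermitian_of_isSymm hG).eigenvalues j < 0} := by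
    rw [negIndex_congr (isHermitian_pencil d L hLs w) (hFH w) hbase, hνFw]
    exact negIndex_congr (hFH 0) _ (by simp only [hF, zero_smul, add_zero])
  rw [hνend, hνbase, hpoly] at hgap
  refine hgap.trans (Multiset.card_le_card (Multiset.monotone_filter_right _ fun T hT => ?_))
  exact lt_trans hw0 hT.1

/-- **NEGATIVE HALF-LINE FLUX**: at least `|π(S) − ν(G)|` roots in `(−∞, 0)` with multiplicity (index runs from `ν(G)` at `0⁻` to
`ν(−S) = π(S)` at `−∞`); obtained from the positive flux of the mirrored letter `−S`. [this work] -/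
theorem card_negRoots_fibre_ge (G S : Matrix ι ι ℝ) (hG : G.IsSymm) (hS : S.IsSymm) (hGdet : G.det ≠ 0) (hSdet : S.det ≠ 0) :
    Nat.dist (Fintype.card {j // 0 < (isHermitian_of_isSymm hS).eigenvalues j})
        (Fintype.card {j // (isHermitian_of_isSymm hG).eigenvalues j < 0})
      ≤ Multiset.card (((X : ℝ[X]) • S.map C + G.map C).det.roots.filter (fun T => T < 0)) := by
  classical
  have hnSdet : (-S).det ≠ 0 := by
    rw [det_neg]; exact mul_ne_zero (pow_ne_zero _ (by norm_num)) hSdet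
  have h := card_posRoots_fibre_ge G (-S) hG hS.neg hGdet hnSdet
  rw [← posIndex_eq_negIndex_neg (isHermitian_of_isSymm hS) (isHermitian_of_isSymm hS.neg)] at h
  -- the mirrored fibre polynomial is the composition with `−X`
  have hcomp : ((X : ℝ[X]) • (-S).map C + G.map C).det = (((X : ℝ[X]) • S.map C + G.map C).det).comp (-X) := by
    have hring : (((X : ℝ[X]) • S.map C + G.map C).det).comp (-X) =
        (((X : ℝ[X]) • S.map C + G.map C).map (Polynomial.compRingHom (-X))).det := by
      rw [← Polynomial.coe_compRingHom_apply, RingHom.map_det, RingHom.mapMatrix_apply]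
    rw [hring]
    congr 1
    ext i j
    simp only [Matrix.map_apply, Matrix.add_apply, Matrix.smul_apply, Matrix.neg_apply, smul_eq_mul,
      Polynomial.coe_compRingHom_apply, map_neg, mul_comp, X_comp, C_comp, add_comp]
    ring
  rw [hcomp] at h
  refine h.trans ?_
  -- roots of `p ∘ (−X)` in `(0,∞)` are the negatives of the roots of `p` in `(−∞,0)`
  rw [Polynomial.roots_comp_neg_X, Multiset.filter_map, Multiset.card_map]
  refine Multiset.card_le_card (Multiset.monotone_filter_right _ fun T hT => ?_)
  simpa using hT

/-- **SIGNED FLUX**: `#{real fibre roots} ≥ |ν(S) − ν(G)| + |π(S) − ν(G)|` (with multiplicity), for `G`, `S` real symmetric non-singular —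
refines the prequel's `|π(S) − ν(S)|`. [this work] -/
theorem card_roots_fibre_ge_signed_flux (G S : Matrix ι ι ℝ) (hG : G.IsSymm) (hS : S.IsSymm) (hGdet : G.det ≠ 0) (hSdet : S.det ≠ 0) :
    Nat.dist (Fintype.card {j // (isHermitian_of_isSymm hS).eigenvalues j < 0})
        (Fintype.card {j // (isHermitian_of_isSymm hG).eigenvalues j < 0}) +
      Nat.dist (Fintype.card {j // 0 < (isHermitian_of_isSymm hS).eigenvalues j})
        (Fintype.card {j // (isHermitian_of_isSymm hG).eigenvalues j < 0})
      ≤ Multiset.card ((X : ℝ[X]) • S.map C + G.map C).det.roots := by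
  classical
  have h1 := card_posRoots_fibre_ge G S hG hS hGdet hSdet
  have h2 := card_negRoots_fibre_ge G S hG hS hGdet hSdet
  have hsplit : Multiset.card (((X : ℝ[X]) • S.map C + G.map C).det.roots.filter (fun T => 0 < T)) +
      Multiset.card (((X : ℝ[X]) • S.map C + G.map C).det.roots.filter (fun T => T < 0)) ≤
      Multiset.card ((X : ℝ[X]) • S.map C + G.map C).det.roots := by
    rw [← Multiset.card_add]
    refine Multiset.card_le_card (Multiset.le_iff_count.mpr fun T => ?_)
    rw [Multiset.count_add, Multiset.count_filter, Multiset.count_filter]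
    by_cases h0 : 0 < T
    · rw [if_pos h0, if_neg (not_lt.mpr h0.le), add_zero]
    · rw [if_neg h0, zero_add]
      split_ifs
      · exact le_rfl
      · exact Nat.zero_le _
  omega

end Signed

/-! ## §2 A definite base has totally real fibres: no fold over the definite zone -/

section Definite

/-- the negative index of a positive definite matrix vanishes. [folklore] -/
theorem negIndex_eq_zero_of_posDef {G : Matrix ι ι ℝ} (hG : G.PosDef) (hGs : G.IsSymm) :
    Fintype.card {j // (isHermitian_of_isSymm hGs).eigenvalues j < 0} = 0 := by
  rw [Fintype.card_eq_zero_iff]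
  refine ⟨fun j => ?_⟩
  have hpos : 0 < (isHermitian_of_isSymm hGs).eigenvalues j.1 := hG.eigenvalues_pos j.1
  exact absurd j.2 (not_lt.mpr hpos.le)

/-- **TOTALLY REAL FIBRES OVER A DEFINITE BASE.**  If `G ≻ 0` and `S` is real symmetric non-singular of indices `(p, q)`, the fibre polynomial
`det (X·S + G)` (degree `m = p + q`) has exactly `q` positive and `p` negative roots and ALL its roots are real (`m` with multiplicity): no far
letter folds over a point where the class pencil is definite. [this work; classical for definite pencils] -/
theorem card_roots_fibre_eq_card_of_posDef (G S : Matrix ι ι ℝ) (hG : G.PosDef) (hGs : G.IsSymm) (hS : S.IsSymm) (hSdet : S.det ≠ 0) :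
    Multiset.card ((X : ℝ[X]) • S.map C + G.map C).det.roots = Fintype.card ι ∧
    Multiset.card (((X : ℝ[X]) • S.map C + G.map C).det.roots.filter (fun T => 0 < T)) =
      Fintype.card {j // (isHermitian_of_isSymm hS).eigenvalues j < 0} ∧
    Multiset.card (((X : ℝ[X]) • S.map C + G.map C).det.roots.filter (fun T => T < 0)) =
      Fintype.card {j // 0 < (isHermitian_of_isSymm hS).eigenvalues j} := by
  classical
  have hGdet : G.det ≠ 0 := hG.det_pos.ne'
  have h1 := card_posRoots_fibre_ge G S hGs hS hGdet hSdet
  have h2 := card_negRoots_fibre_ge G S hGs hS hGdet hSdet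
  rw [negIndex_eq_zero_of_posDef hG hGs] at h1 h2
  have hsum := negIndex_add_posIndex_add_corank (isHermitian_of_isSymm hS)
  rw [corank_eq_zero_of_det_ne_zero hSdet, add_zero] at hsum
  have hdeg : Multiset.card ((X : ℝ[X]) • S.map C + G.map C).det.roots ≤ Fintype.card ι := by
    have := Polynomial.card_roots' ((X : ℝ[X]) • S.map C + G.map C).det
    rwa [natDegree_det_fibre G S hSdet] at this
  have hsplit : Multiset.card (((X : ℝ[X]) • S.map C + G.map C).det.roots.filter (fun T => 0 < T)) +
      Multiset.card (((X : ℝ[X]) • S.map C + G.map C).det.roots.filter (fun T => T < 0)) ≤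
      Multiset.card ((X : ℝ[X]) • S.map C + G.map C).det.roots := by
    rw [← Multiset.card_add]
    refine Multiset.card_le_card (Multiset.le_iff_count.mpr fun T => ?_)
    rw [Multiset.count_add, Multiset.count_filter, Multiset.count_filter]
    by_cases h0 : 0 < T
    · rw [if_pos h0, if_neg (not_lt.mpr h0.le), add_zero]
    · rw [if_neg h0, zero_add]
      split_ifs
      · exact le_rfl
      · exact Nat.zero_le _
  unfold Nat.dist at h1 h2
  refine ⟨by omega, by omega, by omega⟩

end Definite

end Summit.ValiantsHypothesis.ValiantsHypothesis.Theorems.KPlusLogSqLaw.TowerGraft
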